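/-
Copyright (c) 2026 the pub-hodgecm-mathlib formalisation cell (harness21).  Prover seat hodgecm-mathlib-LH4-p01 (g17), req618 STAGE 1a «(D-RAM) FOUR-FRAME» squad of
crux H413 (director s1808; heir LEAD F0P3a-plan (g18) T17-27 DIRECTIVE b9ecbbedecc9c5ae D2 §1 item 3 ∕ D3 ∕ D7; dealer LH4-plan (g10) WORD #5 deal g10-#10
«(ii-G) ANCHOR DICTIONARY, t = 0»), 2026-09-03: the census dictionary Prop `AnchorCountDictionary 0` of the sibling line `Cruxes/H413/Lines/F0_P3c_DyRamFourFrame.lean` IS PAID.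
-/
import Summits.HodgeConjecture.HodgeConjecture.Theorems.F0P3cDyRamFourFrameDictionaryDefs   -- №2b (dealer LH4-plan (g10), filed by LH4-p03): `AnchorCountDictionary t` (GATE 1a-1 (D-G) VERBATIM)
import Literature.NumberTheory.Automorphic.UnitaryThreeFourFrameFixedCosetDictionary        -- ★ B-p04 (g61): `natCard_fixedBy_quotient_eq_fixedVertexCount_of_coe_eq_smul` (fixed cosets ↔ fixed vertices, `z`-blind)
import Literature.NumberTheory.Automorphic.UnitaryThreeFourFrameEigenframe                 -- ★ B-p04 (g61): `exists_eigenframe_smul_frameElt` (`(z·Γ_b)·Q_b = Q_b·diag(zα, zβ, z)`, `Q_b` invertible), `injective_eigenvalues`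
import Literature.NumberTheory.Automorphic.UnitOrbitalIntegralFixedPointsVolume              -- ★ B-p04 (g34): `classOrbitalIntegral_indicator_complex_local_eq_natCard_fixedBy_mul` (`Φ(⟦γ⟧, 𝟙_C) = #Fix_γ(G ⧸ C)·ν(C)`)
import Literature.NumberTheory.Automorphic.UnitaryEllipticCentralizerCompactNonsplit        -- ★ B-p10: `compactSpace_centralizer_of_eigenframe_of_smul_eq` (elliptic regular ⇒ compact centraliser)
import Literature.NumberTheory.Rogawski1990.UnitOrbitalIntegralValueOfCongr                 -- ★ B-p14: `isRegularElt_of_eigenframe`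
import Literature.NumberTheory.Rogawski1990.UnitaryVertexStabilizerSpanSelfDualStdCM          -- ★ F0P2-p06: `mem_cmLocalIntegralLevel_iff_mapGL_stdLattice_eq` (`K_std` = stabiliser of `𝒪_w³`)
import Literature.NumberTheory.Rogawski1990.UnitaryLatticeTreeSelfDualTransitiveWildCM       -- ★ p854598 (this seat): `exists_unitary_mapGL_eq_of_isSelfDualLattice_ramifiedCM` (htr₀-WILD at a ramified CM place)
import Literature.NumberTheory.Rogawski1990.ExplicitFactorKappaAlmostEverywhereOne           -- ★ `conjLocal_apply_eq_galAdicCompletionMap` (`(c ⊗ 1)(x)_w = σ_w(x_w)`)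
import Literature.NumberTheory.Rogawski1990.UnipotentLevelPiecesFrameCM                    -- ★ `exists_continuousMulEquiv_coe_eq_localNonsplitEquiv` (the one-place model on the `cmDatum` carrier)
import Literature.NumberTheory.Rogawski1990.EulerPoincareNonEllipticThree                  -- ★ `placeForm_antidiagThree_eq_over` (`(Φ₃)_w = J₀` in the `StdForm` spelling)
import HarnessLib

/-!
# F0 · P3c · line LH4 «(D-RAM) FOUR-FRAME» — unit (ii-G): THE CENSUS DICTIONARY AT THE TYPE-`0` ANCHOR, `anchorCountDictionary_zero : AnchorCountDictionary 0`
# (Kottwitz 1986 §3; Rogawski 1990 §4.9 Prop. 4.9.1 (b); Laumon 1996 Lemma (5.3.2))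

Cell `pub/hodgecm-mathlib`, crux H413 = `stmt-HodgeConjecture-24833` (helper lane `--supports stmt-HodgeConjecture-24833`), route HCCMUnconditional; THEOREMS ONLY
(no definition, no instance, no notation, no named fact, no `sorry`, no `set_option` beyond `autoImplicit false`; default heartbeats).  Conclusion = the dealer's №2b Prop
`Summit.….Cruxes.H413.F0P3cDyRamFourFrameDictionaryDefs.AnchorCountDictionary 0` BY NAME.

THE MATHEMATICS.  At a ramified non-split place `w ∣ v` of the CM field `L` (no `|2|_w = 1`), `G = U(Φ₃)(L⁺_v)` with its one-place model `e : G ≃ₜ* U(σ_w, Φ₃)(L_w)`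
(★ `localNonsplitEquiv`; `(Φ₃)_w = J₀`), `N` a SELF-DUAL vertex of `(L_w³, J₀)` and `K₀ = Stab_G(N)`; `γ ∈ G` with `e(γ) = z·Γ`, `Γ = frameElt σ_w f b α β = 1 + (α−1)π₁ + (β−1)π₂`
for a four-frame family `f` (`π_i` the frame projections of `f b 0`, `f b 1`), `α, β, z ∈ L_w¹`, `α ≠ β`, `α, β ≠ 1`.
(1) EIGENFRAME: `(z·Γ)·F = F·diag(zα, zβ, z)` for the invertible frame matrix `F = (f b 0 | f b 1 | f b 2)` (★ B-p04 `exists_eigenframe_smul_frameElt`); pulled back along `L ⊗ L⁺_v ≃ L_w` (one place above `v`) it is an eigenframe of `γ` over `E_v` with eigenvalues `zα, zβ, z` — pairwise distinct of norm one —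
so `γ` is REGULAR (★ `isRegularElt_of_eigenframe`) with COMPACT centraliser (★ `compactSpace_centralizer_of_eigenframe_of_smul_eq`).  (2) `K₀` IS COMPACT OPEN: by htr₀-WILD at the
CM place (★ p854598) `N = e(g₀)·𝒪_w³`, so `K₀ = g₀·U(Φ₃)(𝒪_v)·g₀⁻¹` (★ `mem_cmLocalIntegralLevel_iff_mapGL_stdLattice_eq`, ★ `isCompact_isOpen_cmLocalIntegralLevel`).  (3) Hence ★
`classOrbitalIntegral_indicator_complex_local_eq_natCard_fixedBy_mul`: `Φ(⟦γ⟧, 1_{K₀}; mG₃) = #Fix_γ(G ⧸ K₀) · νG₃(K₀)` for the CANONICAL family `mG₃` (torus mass one on the compact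
centraliser), and ★ B-p04's dictionary `#Fix_γ(G ⧸ K₀) = fixedVertexCount σ_w ϖ 0 Γ` (transitivity on self-dual vertices = ★ p854598; type preservation; `|z| = 1`).  The constant is
`C := νG₃(K₀)` — it depends on `(νG₃, N)` only, as the Prop allows (`∃ C` after `∀ N ∀ K_t`).

* §1 (CM place) **`exists_eigenframe_localRing_of_coe_eq_smul_frameElt`** (the `E_v`-eigenframe `(Q, u)` of `γ`: `γ·Q = Q·diag(u)`,
  `u` injective, `σ(u_i)u_i = 1` — ★ B-p04's `L_w`-eigenframe `exists_eigenframe_smul_frameElt` pulled back along `L ⊗ L⁺_v ≃ L_w`),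
  **`isCompact_and_isOpen_of_forall_mem_iff_mapGL_eq`** (the stabiliser of a self-dual vertex is compact open).
* §2 **`classOrbitalIntegral_indicator_eq_mul_fixedVertexCount_zero`** (all binders explicit) and the head **`anchorCountDictionary_zero : AnchorCountDictionary 0`**.

HONEST LABEL: HC_CM is proved only modulo the 7 printed citations (2 remaining named inputs: hLiu418 = stmt-HodgeConjecture-24832, h413 = stmt-HodgeConjecture-24833) until
rung 0 closes; this file pays the LAYER-2 Prop (D-G) at `t = 0` of the sibling line (count-neutral until the line closes its organ).

## References
* [Kottwitz1986BaseChangeUnits] R. E. Kottwitz, *Base change for unit elements of Hecke algebras*, Compositio Math. 60 (1986) 237–250, §1 pp. 240–241 (orbital integrals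
  of `1_K` as fixed-coset counts).
* [Rogawski1990] J. D. Rogawski, *Automorphic Representations of Unitary Groups in Three Variables*, Ann. of Math. Stud. 123 (1990), §4.9 p. 54, Prop. 4.9.1 (b) p. 55
  (near-identity orbital integrals at a non-split place as counts of fixed vertices), §3.6 pp. 31–32 (elliptic tori `(L_w¹)³`), §4.3 (4.3.1) p. 43 (measures).
* [Laumon1995] G. Laumon, *Cohomology of Drinfeld Modular Varieties* I (1996), (4.3.11) p. 83, Lemma (5.3.2) p. 136.
* [BruhatTits1972] F. Bruhat, J. Tits, *Groupes réductifs sur un corps local I*, Publ. Math. IHÉS 41 (1972), §10 (vertex stabilisers are compact open; one orbit of special vertices).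
-/

set_option autoImplicit false

noncomputable section

open scoped Valued WithZero Matrix MatrixGroups
open MeasureTheory Measure NumberField IsDedekindDomain Matrix
open Literature.NumberTheory.Automorphic Literature.NumberTheory.Automorphic.UnitaryGroup Literature.NumberTheory.Automorphic.HermitianLattice
open Literature.NumberTheory.Automorphic.UnitaryLatticeTree Literature.NumberTheory.Automorphic.UnitaryThreeFourFrame
open Literature.NumberTheory.Rogawski1990

namespace Summit.HodgeConjecture.HodgeConjecture.Cruxes.H413.F0P3cDyRamAnchorCountDictionaryZero

/-! ## §1 At the CM place: the `E_v`-eigenframe of `γ`, and the stabiliser of a self-dual vertex is compact open -/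

section CM

variable (L : Type) [Field L] [NumberField L] [IsCMField L] {v : HeightOneSpectrum (𝓞 ↥(maximalRealSubfield L))}
  (w : PlacesOver L v) (hw : IsCMField.complexConj L • w.1 = w.1)

include hw in
/-- **THE `E_v`-EIGENFRAME OF `γ`**: if the one-place matrix of `γ ∈ U(Φ₃)(L⁺_v)` is `z·frameElt σ_w f b α β` (four-frame family `f`; `α, β, z ∈ L_w¹`, `α ≠ β`, `α, β ≠ 1`),
then over `E_v = L ⊗ L⁺_v ≃ L_w` (`v` non-split) `γ·Q = Q·diag(u)` for an invertible `Q` and `u` INJECTIVE with `σ(u_i)·u_i = 1` — the frame matrix and the eigenvalues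
`(zα, zβ, z)` pulled back along the one-factor isomorphism. [cite: Rogawski1990, §3.6 pp. 31–32] [cite: Kottwitz1986BaseChangeUnits, §1 pp. 240–241] -/
theorem exists_eigenframe_localRing_of_coe_eq_smul_frameElt
    (γ : (cmDatum L 3 (Matrix.of fun i j : Fin 3 => if i.val + j.val + 1 = 3 then (1 : L) else 0)).Local v)
    {f : Fin 4 → Fin 3 → (Fin 3 → (w.1.adicCompletion L))} (hf : IsFourFrameFamily (galAdicCompletionMap (L := L) (IsCMField.complexConj L) hw) f)
    {α β z : w.1.adicCompletion L} (hα : α * (galAdicCompletionMap (L := L) (IsCMField.complexConj L) hw) α = 1)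
    (hβ : β * (galAdicCompletionMap (L := L) (IsCMField.complexConj L) hw) β = 1) (hz : z * (galAdicCompletionMap (L := L) (IsCMField.complexConj L) hw) z = 1)
    (hαβ : α ≠ β) (hα1 : α ≠ 1) (hβ1 : β ≠ 1) (b : Fin 4) {Γ : GL (Fin 3) (w.1.adicCompletion L)}
    (hΓ : (Γ : Matrix (Fin 3) (Fin 3) (w.1.adicCompletion L)) = frameElt (galAdicCompletionMap (L := L) (IsCMField.complexConj L) hw) f b α β)
    (hγ : ((((localNonsplitEquiv (IsCMField.complexConj L) (Matrix.of fun i j : Fin 3 => if i.val + j.val + 1 = 3 then (1 : L) else 0) (IsCMField.complexConj_ne_one L) w hw γ :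
        ↥(unitaryGroupOfForm (galAdicCompletionMap (L := L) (IsCMField.complexConj L) hw) (placeForm (Matrix.of fun i j : Fin 3 => if i.val + j.val + 1 = 3 then (1 : L) else 0) w.1))) :
        GL (Fin 3) (w.1.adicCompletion L)) : Matrix (Fin 3) (Fin 3) (w.1.adicCompletion L))) = z • (Γ : Matrix (Fin 3) (Fin 3) (w.1.adicCompletion L))) :
    ∃ (Q : GL (Fin 3) (LocalRing L v)) (u : Fin 3 → LocalRing L v),
      (γ.val.val : Matrix (Fin 3) (Fin 3) (LocalRing L v)) * Q.val = Q.val * Matrix.diagonal u ∧ Function.Injective u ∧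
        ∀ i, conjLocal L (IsCMField.complexConj L) v (u i) * u i = 1 := by
  have hc1 : IsCMField.complexConj L ≠ 1 := IsCMField.complexConj_ne_one L
  haveI : Subsingleton (PlacesOver L v) := PlacesOver.subsingleton_of_smul_eq (IsCMField.complexConj L) hc1 w hw
  letI : Unique (PlacesOver L v) := uniqueOfSubsingleton w
  let πe : LocalRing L v ≃+* w.1.adicCompletion L := RingEquiv.piUnique fun w' : PlacesOver L v => w'.1.adicCompletion L
  have hπe : ∀ x : LocalRing L v, πe x = x w := fun _ => rfl
  have hz0 : z ≠ 0 := fun h => by rw [h, zero_mul] at hz; exact zero_ne_one hz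
  -- the frame matrix over `L_w` and its eigen-relation for `z·Γ` (★ B-p04)
  obtain ⟨F, -, hΓF⟩ := exists_eigenframe_smul_frameElt hf b α β z
  set lam : Fin 3 → w.1.adicCompletion L := ![z * α, z * β, z] with hlam
  have hlam_inj : Function.Injective lam := injective_eigenvalues hαβ hα1 hβ1 hz0
  -- pull back along `πe`: `Q = F.map πe⁻¹`, `u = πe⁻¹ ∘ (zα, zβ, z)`
  set Q : GL (Fin 3) (LocalRing L v) := Matrix.GeneralLinearGroup.map (πe.symm : w.1.adicCompletion L →+* LocalRing L v) F with hQdef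
  have hQval : (Q.val : Matrix (Fin 3) (Fin 3) (LocalRing L v)) = (F : Matrix (Fin 3) (Fin 3) (w.1.adicCompletion L)).map (πe.symm : w.1.adicCompletion L →+* LocalRing L v) := rfl
  have hFe : (Q.val : Matrix (Fin 3) (Fin 3) (LocalRing L v)).map (πe : LocalRing L v →+* w.1.adicCompletion L) = (F : Matrix (Fin 3) (Fin 3) (w.1.adicCompletion L)) := by
    rw [hQval, Matrix.map_map]
    convert Matrix.map_id (F : Matrix (Fin 3) (Fin 3) (w.1.adicCompletion L)) using 2
    funext x; exact πe.apply_symm_apply x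
  set u : Fin 3 → LocalRing L v := fun i => πe.symm (lam i) with hu_def
  have hue : ∀ i, πe (u i) = lam i := fun i => πe.apply_symm_apply _
  refine ⟨Q, u, ?_, ?_, ?_⟩
  · -- the eigen-relation, checked after `πe`
    have hinj : Function.Injective (fun M : Matrix (Fin 3) (Fin 3) (LocalRing L v) => M.map (πe : LocalRing L v →+* w.1.adicCompletion L)) :=
      fun M M' h => by
        have h' := congrArg (fun M : Matrix (Fin 3) (Fin 3) (w.1.adicCompletion L) => M.map (πe.symm : w.1.adicCompletion L →+* LocalRing L v)) h
        simpa [Matrix.map_map, Function.comp_def] using h'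
    apply hinj
    show ((γ.val.val : Matrix (Fin 3) (Fin 3) (LocalRing L v)) * Q.val).map (πe : LocalRing L v →+* w.1.adicCompletion L) =
      (Q.val * Matrix.diagonal u).map (πe : LocalRing L v →+* w.1.adicCompletion L)
    rw [Matrix.map_mul, Matrix.map_mul, hFe, Matrix.diagonal_map (map_zero _)]
    have hγe : (γ.val.val : Matrix (Fin 3) (Fin 3) (LocalRing L v)).map (πe : LocalRing L v →+* w.1.adicCompletion L) =
        z • (Γ : Matrix (Fin 3) (Fin 3) (w.1.adicCompletion L)) := by
      rw [← hγ]; rfl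
    have hue' : (fun i => (πe : LocalRing L v →+* w.1.adicCompletion L) (u i)) = lam := funext hue
    rw [hγe, hΓ, hΓF, hue']
  · -- `u` is injective
    intro i j hij
    exact hlam_inj (by rw [← hue, ← hue, hij])
  · -- norm one, checked after `πe`: `σ_w(λ_i)·λ_i = 1`
    have hn : ∀ x y : w.1.adicCompletion L, x * galAdicCompletionMap (L := L) (IsCMField.complexConj L) hw x = 1 →
        y * galAdicCompletionMap (L := L) (IsCMField.complexConj L) hw y = 1 →
        galAdicCompletionMap (L := L) (IsCMField.complexConj L) hw (x * y) * (x * y) = 1 := fun x y hx hy => by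
      rw [map_mul]; linear_combination (galAdicCompletionMap (L := L) (IsCMField.complexConj L) hw y * y) * hx + hy
    intro i
    apply πe.injective
    rw [map_mul, map_one, hπe (conjLocal L (IsCMField.complexConj L) v (u i)), conjLocal_apply_eq_galAdicCompletionMap L v w hw, ← hπe (u i), hue]
    fin_cases i
    · exact hn z α hz hα
    · exact hn z β hz hβ
    · simpa [hlam, mul_comm] using hz

include hw in
/-- **THE STABILISER OF A SELF-DUAL VERTEX IS COMPACT OPEN** at a ramified non-split place: `K₀ = {u | e(u)·N = N}` for a self-dual `N` is `g₀·U(Φ₃)(𝒪_v)·g₀⁻¹` with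
`e(g₀)·𝒪_w³ = N` (htr₀-WILD at the CM place, ★ `exists_unitary_mapGL_eq_of_isSelfDualLattice_ramifiedCM`; ★ `mem_cmLocalIntegralLevel_iff_mapGL_stdLattice_eq`), and
`U(Φ₃)(𝒪_v)` is compact open (★ `isCompact_isOpen_cmLocalIntegralLevel`). [cite: BruhatTits1972, §10] [cite: Rogawski1990, §4.9 p. 54] -/
theorem isCompact_and_isOpen_of_forall_mem_iff_mapGL_eq (he : v.asIdeal.ramificationIdx' w.1.asIdeal ≠ 1)
    {ϖ : w.1.adicCompletion L} (hϖ : Valued.v ϖ = WithZero.exp (-1 : ℤ))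
    {N : Submodule 𝒪[w.1.adicCompletion L] (Fin 3 → w.1.adicCompletion L)}
    (hN : IsVertexLattice (galAdicCompletionMap (L := L) (IsCMField.complexConj L) hw) ϖ ((StdForm.antidiagonal 3).over (w.1.adicCompletion L)) 0 N)
    (Kt : Subgroup ((cmDatum L 3 (Matrix.of fun i j : Fin 3 => if i.val + j.val + 1 = 3 then (1 : L) else 0)).Local v))
    (hKt : ∀ u : ((cmDatum L 3 (Matrix.of fun i j : Fin 3 => if i.val + j.val + 1 = 3 then (1 : L) else 0)).Local v), u ∈ Kt ↔
      mapGL ((localNonsplitEquiv (IsCMField.complexConj L) (Matrix.of fun i j : Fin 3 => if i.val + j.val + 1 = 3 then (1 : L) else 0) (IsCMField.complexConj_ne_one L) w hw u :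
        ↥(unitaryGroupOfForm (galAdicCompletionMap (L := L) (IsCMField.complexConj L) hw) (placeForm (Matrix.of fun i j : Fin 3 => if i.val + j.val + 1 = 3 then (1 : L) else 0) w.1))) :
        GL (Fin 3) (w.1.adicCompletion L)) N = N) :
    IsCompact (Kt : Set ((cmDatum L 3 (Matrix.of fun i j : Fin 3 => if i.val + j.val + 1 = 3 then (1 : L) else 0)).Local v)) ∧
      IsOpen (Kt : Set ((cmDatum L 3 (Matrix.of fun i j : Fin 3 => if i.val + j.val + 1 = 3 then (1 : L) else 0)).Local v)) := by
  obtain ⟨e, hecoe⟩ := exists_continuousMulEquiv_coe_eq_localNonsplitEquiv L (Matrix.of fun i j : Fin 3 => if i.val + j.val + 1 = 3 then (1 : L) else 0) v w hw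
  have hKt' : ∀ y, y ∈ Kt ↔ mapGL ((e y : ↥(unitaryGroupOfForm (galAdicCompletionMap (L := L) (IsCMField.complexConj L) hw)
      (placeForm (Matrix.of fun i j : Fin 3 => if i.val + j.val + 1 = 3 then (1 : L) else 0) w.1))) : GL (Fin 3) (w.1.adicCompletion L)) N = N := fun y => by
    rw [hecoe]; exact hKt y
  have hpf := placeForm_antidiagThree_eq_over L w
  -- the root `𝒪_w³` is self-dual, hence `N = e(g₀)·𝒪_w³`
  have hϖ1 : Valued.v ϖ ≤ 1 := by rw [hϖ, ← WithZero.exp_zero]; exact WithZero.exp_le_exp.2 (by norm_num)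
  have hJ : ∀ i j : Fin 3, (StdForm.antidiagonal 3).over (w.1.adicCompletion L) i j = if j = Fin.rev i then (1 : w.1.adicCompletion L) else 0 := by
    intro i j
    simp only [StdForm.over, Matrix.map_apply, StdForm.antidiagonal_J_apply]
    split_ifs <;> simp
  have hstd : IsSelfDualLattice (galAdicCompletionMap (L := L) (IsCMField.complexConj L) hw) ϖ ((StdForm.antidiagonal 3).over (w.1.adicCompletion L))
      (stdLattice (w.1.adicCompletion L) 3) := by
    refine isSelfDualLattice_stdLattice (fun i j => ?_) (fun i j => ?_) ?_ hϖ1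
    · rw [hJ]; split_ifs <;> simp
    · rw [StdForm.inv_over, hJ]; split_ifs <;> simp
    · rw [det_antidiagonal_three, Valuation.map_neg, map_one]
  obtain ⟨u₀, hu₀⟩ := exists_unitary_mapGL_eq_of_isSelfDualLattice_ramifiedCM L v w hw he hϖ hstd hN
  have hu₀' : (u₀ : GL (Fin 3) (w.1.adicCompletion L)) ∈ unitaryGroupOfForm (galAdicCompletionMap (L := L) (IsCMField.complexConj L) hw)
      (placeForm (Matrix.of fun i j : Fin 3 => if i.val + j.val + 1 = 3 then (1 : L) else 0) w.1) := by
    rw [hpf]; exact u₀.2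
  set g₀ : (cmDatum L 3 (Matrix.of fun i j : Fin 3 => if i.val + j.val + 1 = 3 then (1 : L) else 0)).Local v :=
    e.symm ⟨(u₀ : GL (Fin 3) (w.1.adicCompletion L)), hu₀'⟩ with hg₀
  have heg₀ : ((e g₀ : ↥(unitaryGroupOfForm (galAdicCompletionMap (L := L) (IsCMField.complexConj L) hw)
      (placeForm (Matrix.of fun i j : Fin 3 => if i.val + j.val + 1 = 3 then (1 : L) else 0) w.1))) : GL (Fin 3) (w.1.adicCompletion L)) =
      (u₀ : GL (Fin 3) (w.1.adicCompletion L)) := by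
    rw [hg₀, ContinuousMulEquiv.apply_symm_apply]
  -- `Kt = g₀·K_std·g₀⁻¹` as a membership statement
  have key : ∀ y, mapGL ((e y : ↥(unitaryGroupOfForm (galAdicCompletionMap (L := L) (IsCMField.complexConj L) hw)
      (placeForm (Matrix.of fun i j : Fin 3 => if i.val + j.val + 1 = 3 then (1 : L) else 0) w.1))) : GL (Fin 3) (w.1.adicCompletion L)) N = N ↔
      mapGL ((u₀ : GL (Fin 3) (w.1.adicCompletion L))⁻¹ * ((e y : ↥(unitaryGroupOfForm (galAdicCompletionMap (L := L) (IsCMField.complexConj L) hw)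
        (placeForm (Matrix.of fun i j : Fin 3 => if i.val + j.val + 1 = 3 then (1 : L) else 0) w.1))) : GL (Fin 3) (w.1.adicCompletion L)) *
        (u₀ : GL (Fin 3) (w.1.adicCompletion L))) (stdLattice (w.1.adicCompletion L) 3) = stdLattice (w.1.adicCompletion L) 3 := by
    intro y
    rw [mapGL_mul, mapGL_mul, hu₀]
    constructor
    · intro h; rw [h, ← hu₀, mapGL_inv_mapGL]
    · intro h
      have h' := congrArg (mapGL (u₀ : GL (Fin 3) (w.1.adicCompletion L))) h
      rw [← mapGL_mul, mul_inv_cancel, mapGL_one, hu₀] at h'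
      exact h'
  have hmem : ∀ y, y ∈ Kt ↔ g₀⁻¹ * y * g₀ ∈ cmLocalIntegralLevel L 3 (Matrix.of fun i j : Fin 3 => if i.val + j.val + 1 = 3 then (1 : L) else 0) v := by
    intro y
    rw [hKt' y, key y, mem_cmLocalIntegralLevel_iff_mapGL_stdLattice_eq L (Matrix.of fun i j : Fin 3 => if i.val + j.val + 1 = 3 then (1 : L) else 0) v w hw, ← hecoe,
      map_mul, map_mul, map_inv, Subgroup.coe_mul, Subgroup.coe_mul, Subgroup.coe_inv, heg₀]
  have hcont₁ : Continuous fun y : ((cmDatum L 3 (Matrix.of fun i j : Fin 3 => if i.val + j.val + 1 = 3 then (1 : L) else 0)).Local v) => g₀⁻¹ * y * g₀ :=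
    (continuous_const.mul continuous_id).mul continuous_const
  have hcont₂ : Continuous fun x : ((cmDatum L 3 (Matrix.of fun i j : Fin 3 => if i.val + j.val + 1 = 3 then (1 : L) else 0)).Local v) => g₀ * x * g₀⁻¹ :=
    (continuous_const.mul continuous_id).mul continuous_const
  obtain ⟨hKc, hKo⟩ := isCompact_isOpen_cmLocalIntegralLevel L 3 (Matrix.of fun i j : Fin 3 => if i.val + j.val + 1 = 3 then (1 : L) else 0) v
  have hpre : (Kt : Set ((cmDatum L 3 (Matrix.of fun i j : Fin 3 => if i.val + j.val + 1 = 3 then (1 : L) else 0)).Local v)) =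
      (fun y => g₀⁻¹ * y * g₀) ⁻¹' (cmLocalIntegralLevel L 3 (Matrix.of fun i j : Fin 3 => if i.val + j.val + 1 = 3 then (1 : L) else 0) v :
        Set ((cmDatum L 3 (Matrix.of fun i j : Fin 3 => if i.val + j.val + 1 = 3 then (1 : L) else 0)).Local v)) := by
    ext y; exact hmem y
  have himg : (Kt : Set ((cmDatum L 3 (Matrix.of fun i j : Fin 3 => if i.val + j.val + 1 = 3 then (1 : L) else 0)).Local v)) =
      (fun x => g₀ * x * g₀⁻¹) '' (cmLocalIntegralLevel L 3 (Matrix.of fun i j : Fin 3 => if i.val + j.val + 1 = 3 then (1 : L) else 0) v :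
        Set ((cmDatum L 3 (Matrix.of fun i j : Fin 3 => if i.val + j.val + 1 = 3 then (1 : L) else 0)).Local v)) := by
    ext y
    simp only [Set.mem_image, SetLike.mem_coe]
    constructor
    · intro hy
      exact ⟨g₀⁻¹ * y * g₀, (hmem y).1 hy, by group⟩
    · rintro ⟨x, hx, rfl⟩
      refine (hmem _).2 ?_
      rw [show g₀⁻¹ * (g₀ * x * g₀⁻¹) * g₀ = x by group]
      exact hx
  exact ⟨himg ▸ hKc.image hcont₂, hpre ▸ hKo.preimage hcont₁⟩

end CM

/-! ## §2 The head: `AnchorCountDictionary 0` -/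

section Head

variable (L : Type) [Field L] [NumberField L] [IsCMField L] {v : HeightOneSpectrum (𝓞 ↥(maximalRealSubfield L))}
  (w : PlacesOver L v) (hw : IsCMField.complexConj L • w.1 = w.1)

include hw in
/-- **THE DICTIONARY AT ONE PLACE, ALL BINDERS EXPLICIT**: for the canonical family `mG₃`, a self-dual vertex `N` with stabiliser `K₀` (membership statement `hKt`), a four-frame
family `f`, `α, β, z ∈ L_w¹` with `α ≠ β`, `α, β ≠ 1`, `Γ = frameElt σ_w f b α β` and `γ` with one-place matrix `z·Γ`:
`Φ(⟦γ⟧, 1_{K₀}; mG₃) = νG₃(K₀) · fixedVertexCount σ_w ϖ 0 Γ`. [cite: Kottwitz1986BaseChangeUnits, §1 pp. 240–241] [cite: Rogawski1990, §4.9 Prop. 4.9.1 (b) p. 55] [cite: Laumon1995, Lemma (5.3.2) p. 136] -/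
theorem classOrbitalIntegral_indicator_eq_mul_fixedVertexCount_zero (he : v.asIdeal.ramificationIdx' w.1.asIdeal ≠ 1)
    {ϖ : w.1.adicCompletion L} (hϖ : Valued.v ϖ = WithZero.exp (-1 : ℤ))
    [MeasurableSpace ((cmDatum L 3 (Matrix.of fun i j : Fin 3 => if i.val + j.val + 1 = 3 then (1 : L) else 0)).Local v)]
    [BorelSpace ((cmDatum L 3 (Matrix.of fun i j : Fin 3 => if i.val + j.val + 1 = 3 then (1 : L) else 0)).Local v)]
    [∀ γ : ((cmDatum L 3 (Matrix.of fun i j : Fin 3 => if i.val + j.val + 1 = 3 then (1 : L) else 0)).Local v),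
      MeasurableSpace (((cmDatum L 3 (Matrix.of fun i j : Fin 3 => if i.val + j.val + 1 = 3 then (1 : L) else 0)).Local v) ⧸
        Subgroup.centralizer ({γ} : Set ((cmDatum L 3 (Matrix.of fun i j : Fin 3 => if i.val + j.val + 1 = 3 then (1 : L) else 0)).Local v)))]
    [∀ γ : ((cmDatum L 3 (Matrix.of fun i j : Fin 3 => if i.val + j.val + 1 = 3 then (1 : L) else 0)).Local v),
      BorelSpace (((cmDatum L 3 (Matrix.of fun i j : Fin 3 => if i.val + j.val + 1 = 3 then (1 : L) else 0)).Local v) ⧸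
        Subgroup.centralizer ({γ} : Set ((cmDatum L 3 (Matrix.of fun i j : Fin 3 => if i.val + j.val + 1 = 3 then (1 : L) else 0)).Local v)))]
    (νG₃ : Measure ((cmDatum L 3 (Matrix.of fun i j : Fin 3 => if i.val + j.val + 1 = 3 then (1 : L) else 0)).Local v)) [νG₃.IsHaarMeasure] [νG₃.IsMulRightInvariant]
    {mG₃ : OrbitalMeasureFamily ((cmDatum L 3 (Matrix.of fun i j : Fin 3 => if i.val + j.val + 1 = 3 then (1 : L) else 0)).Local v)}
    (hcan : mG₃.IsCanonical (fun γ => IsRegularElt (γ.val : GL (Fin 3) (LocalRing L v))) νG₃)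
    {N : Submodule 𝒪[w.1.adicCompletion L] (Fin 3 → w.1.adicCompletion L)}
    (hN : IsVertexLattice (galAdicCompletionMap (L := L) (IsCMField.complexConj L) hw) ϖ ((StdForm.antidiagonal 3).over (w.1.adicCompletion L)) 0 N)
    (Kt : Subgroup ((cmDatum L 3 (Matrix.of fun i j : Fin 3 => if i.val + j.val + 1 = 3 then (1 : L) else 0)).Local v))
    (hKt : ∀ u : ((cmDatum L 3 (Matrix.of fun i j : Fin 3 => if i.val + j.val + 1 = 3 then (1 : L) else 0)).Local v), u ∈ Kt ↔
      mapGL ((localNonsplitEquiv (IsCMField.complexConj L) (Matrix.of fun i j : Fin 3 => if i.val + j.val + 1 = 3 then (1 : L) else 0) (IsCMField.complexConj_ne_one L) w hw u :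
        ↥(unitaryGroupOfForm (galAdicCompletionMap (L := L) (IsCMField.complexConj L) hw) (placeForm (Matrix.of fun i j : Fin 3 => if i.val + j.val + 1 = 3 then (1 : L) else 0) w.1))) :
        GL (Fin 3) (w.1.adicCompletion L)) N = N)
    {f : Fin 4 → Fin 3 → (Fin 3 → (w.1.adicCompletion L))} (hf : IsFourFrameFamily (galAdicCompletionMap (L := L) (IsCMField.complexConj L) hw) f)
    {α β z : w.1.adicCompletion L} (hα : α * (galAdicCompletionMap (L := L) (IsCMField.complexConj L) hw) α = 1)
    (hβ : β * (galAdicCompletionMap (L := L) (IsCMField.complexConj L) hw) β = 1) (hz : z * (galAdicCompletionMap (L := L) (IsCMField.complexConj L) hw) z = 1)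
    (hαβ : α ≠ β) (hα1 : α ≠ 1) (hβ1 : β ≠ 1) (b : Fin 4) {Γ : GL (Fin 3) (w.1.adicCompletion L)}
    (hΓ : (Γ : Matrix (Fin 3) (Fin 3) (w.1.adicCompletion L)) = frameElt (galAdicCompletionMap (L := L) (IsCMField.complexConj L) hw) f b α β)
    (γ : (cmDatum L 3 (Matrix.of fun i j : Fin 3 => if i.val + j.val + 1 = 3 then (1 : L) else 0)).Local v)
    (hγ : ((((localNonsplitEquiv (IsCMField.complexConj L) (Matrix.of fun i j : Fin 3 => if i.val + j.val + 1 = 3 then (1 : L) else 0) (IsCMField.complexConj_ne_one L) w hw γ :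
        ↥(unitaryGroupOfForm (galAdicCompletionMap (L := L) (IsCMField.complexConj L) hw) (placeForm (Matrix.of fun i j : Fin 3 => if i.val + j.val + 1 = 3 then (1 : L) else 0) w.1))) :
        GL (Fin 3) (w.1.adicCompletion L)) : Matrix (Fin 3) (Fin 3) (w.1.adicCompletion L))) = z • (Γ : Matrix (Fin 3) (Fin 3) (w.1.adicCompletion L))) :
    classOrbitalIntegral mG₃ (Set.indicator (Kt : Set ((cmDatum L 3 (Matrix.of fun i j : Fin 3 => if i.val + j.val + 1 = 3 then (1 : L) else 0)).Local v)) (fun _ => (1 : ℂ)))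
        (ConjClasses.mk γ) =
      ((νG₃ Kt).toReal : ℂ) * (fixedVertexCount (galAdicCompletionMap (L := L) (IsCMField.complexConj L) hw) ϖ 0 Γ : ℂ) := by
  have hc1 : IsCMField.complexConj L ≠ 1 := IsCMField.complexConj_ne_one L
  have hpf : placeForm (Matrix.of fun i j : Fin 3 => if i.val + j.val + 1 = 3 then (1 : L) else 0) w.1 = (StdForm.antidiagonal 3).over (w.1.adicCompletion L) :=
    placeForm_antidiagThree_eq_over L w
  have hH : ((Matrix.of fun i j : Fin 3 => if i.val + j.val + 1 = 3 then (1 : L) else 0).map (cmConjRingHom L))ᵀ =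
      Matrix.of fun i j : Fin 3 => if i.val + j.val + 1 = 3 then (1 : L) else 0 := antidiagOne_isHermitian L 3
  have hdet : (Matrix.of fun i j : Fin 3 => if i.val + j.val + 1 = 3 then (1 : L) else 0).det ≠ 0 := (isUnit_antidiagOne_det L 3).ne_zero
  have hvσ : ∀ a : w.1.adicCompletion L, Valued.v (galAdicCompletionMap (L := L) (IsCMField.complexConj L) hw a) = Valued.v a :=
    fun a => valued_galAdicCompletionMap (L := L) (IsCMField.complexConj L) hw a
  -- `K₀` is compact open
  obtain ⟨hKc, hKo⟩ := isCompact_and_isOpen_of_forall_mem_iff_mapGL_eq L w hw he hϖ hN Kt hKt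
  -- the dictionary's homomorphism `ι = e` into `GL₃(L_w)`
  let ι : ((cmDatum L 3 (Matrix.of fun i j : Fin 3 => if i.val + j.val + 1 = 3 then (1 : L) else 0)).Local v) →* GL (Fin 3) (w.1.adicCompletion L) :=
    (Subgroup.subtype _).comp
      (localNonsplitEquiv (IsCMField.complexConj L) (Matrix.of fun i j : Fin 3 => if i.val + j.val + 1 = 3 then (1 : L) else 0) hc1 w hw).toMulEquiv.toMonoidHom
  have hιe : ∀ u, ι u = ((localNonsplitEquiv (IsCMField.complexConj L) (Matrix.of fun i j : Fin 3 => if i.val + j.val + 1 = 3 then (1 : L) else 0) hc1 w hw u :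
      ↥(unitaryGroupOfForm (galAdicCompletionMap (L := L) (IsCMField.complexConj L) hw)
        (placeForm (Matrix.of fun i j : Fin 3 => if i.val + j.val + 1 = 3 then (1 : L) else 0) w.1))) : GL (Fin 3) (w.1.adicCompletion L)) := fun _ => rfl
  have hKt' : ∀ u, u ∈ Kt ↔ mapGL (ι u) N = N := fun u => by rw [hιe]; exact hKt u
  have htype : ∀ u, IsVertexLattice (galAdicCompletionMap (L := L) (IsCMField.complexConj L) hw) ϖ ((StdForm.antidiagonal 3).over (w.1.adicCompletion L)) 0
      (mapGL (ι u) N) := by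
    intro u
    refine isVertexLattice_mapGL (galAdicCompletionMap (L := L) (IsCMField.complexConj L) hw) ϖ _ (ι u) ?_ hN
    rw [hιe, ← hpf]
    exact (localNonsplitEquiv (IsCMField.complexConj L) (Matrix.of fun i j : Fin 3 => if i.val + j.val + 1 = 3 then (1 : L) else 0) hc1 w hw u).2
  have htr : ∀ M : Submodule 𝒪[w.1.adicCompletion L] (Fin 3 → w.1.adicCompletion L),
      IsVertexLattice (galAdicCompletionMap (L := L) (IsCMField.complexConj L) hw) ϖ ((StdForm.antidiagonal 3).over (w.1.adicCompletion L)) 0 M →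
        ∃ u, mapGL (ι u) N = M := by
    intro M hM
    obtain ⟨u₁, hu₁⟩ := exists_unitary_mapGL_eq_of_isSelfDualLattice_ramifiedCM L v w hw he hϖ hN hM
    have hu₁' : (u₁ : GL (Fin 3) (w.1.adicCompletion L)) ∈ unitaryGroupOfForm (galAdicCompletionMap (L := L) (IsCMField.complexConj L) hw)
        (placeForm (Matrix.of fun i j : Fin 3 => if i.val + j.val + 1 = 3 then (1 : L) else 0) w.1) := by
      rw [hpf]; exact u₁.2
    refine ⟨(localNonsplitEquiv (IsCMField.complexConj L) (Matrix.of fun i j : Fin 3 => if i.val + j.val + 1 = 3 then (1 : L) else 0) hc1 w hw).symm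
      ⟨(u₁ : GL (Fin 3) (w.1.adicCompletion L)), hu₁'⟩, ?_⟩
    rw [hιe, ContinuousMulEquiv.apply_symm_apply]
    exact hu₁
  -- `γ` is regular with compact centraliser (the `E_v`-eigenframe)
  obtain ⟨Q, u, hQ, hu, hu1⟩ := exists_eigenframe_localRing_of_coe_eq_smul_frameElt L w hw γ hf hα hβ hz hαβ hα1 hβ1 b hΓ hγ
  have hreg : IsRegularElt (γ.val : GL (Fin 3) (LocalRing L v)) :=
    isRegularElt_of_eigenframe L (Matrix.of fun i j : Fin 3 => if i.val + j.val + 1 = 3 then (1 : L) else 0) w hw γ hQ hu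
  haveI : CompactSpace (Subgroup.centralizer ({γ} : Set ((cmDatum L 3 (Matrix.of fun i j : Fin 3 => if i.val + j.val + 1 = 3 then (1 : L) else 0)).Local v))) :=
    compactSpace_centralizer_of_eigenframe_of_smul_eq L w hw (Matrix.of fun i j : Fin 3 => if i.val + j.val + 1 = 3 then (1 : L) else 0) hH hdet γ hQ hu hu1
  -- the fixed-coset reading and the dictionary
  rw [classOrbitalIntegral_indicator_complex_local_eq_natCard_fixedBy_mul L 3 (Matrix.of fun i j : Fin 3 => if i.val + j.val + 1 = 3 then (1 : L) else 0) v νG₃ hH hdet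
      hcan Kt hKo hKc γ hreg,
    natCard_fixedBy_quotient_eq_fixedVertexCount_of_coe_eq_smul ι N Kt (galAdicCompletionMap (L := L) (IsCMField.complexConj L) hw) ϖ 0 hvσ hKt' htype htr γ hz Γ
      (by rw [hιe]; exact hγ), mul_comm]

/-- **THE CENSUS DICTIONARY AT THE TYPE-`0` ANCHOR — `AnchorCountDictionary 0` HOLDS**, with the constant `C := νG₃(K₀)` (it depends on the measure and the vertex only,
as the Prop's quantifier order `∀ N ∀ K₀ ∃ C` allows); the unused binder `¬ IsUnit 2` shows the dictionary holds at EVERY ramified place, not only the dyadic ones.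
[cite: Kottwitz1986BaseChangeUnits, §1 pp. 240–241] [cite: Rogawski1990, §4.9 Prop. 4.9.1 (b) p. 55; §4.3 (4.3.1) p. 43] [cite: Laumon1995, Lemma (5.3.2) p. 136] -/
theorem anchorCountDictionary_zero : F0P3cDyRamFourFrameDictionaryDefs.AnchorCountDictionary 0 := by
  intro L _ _ _ v w hw he _h2 ϖ hϖ _ _ _ _ νG₃ _ _ mG₃ hcan N hN Kt hKt
  exact ⟨_, fun f hf α β z hα hβ hz hαβ hα1 hβ1 b Γ hΓ γ hγ =>
    classOrbitalIntegral_indicator_eq_mul_fixedVertexCount_zero L w hw he hϖ νG₃ hcan hN Kt hKt hf hα hβ hz hαβ hα1 hβ1 b hΓ γ hγ⟩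

end Head

end Summit.HodgeConjecture.HodgeConjecture.Cruxes.H413.F0P3cDyRamAnchorCountDictionaryZero

end
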